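import Summits.CriticalPhenomena.PercolationContinuityZ3.Theorems.Transplant.FKConnectivityAllQAntipodalTwoSpineDefs
import Summits.CriticalPhenomena.PercolationContinuityZ3.Theorems.Transplant.FKConnectivityAllQAntipodalX2SpineFiber
import Summits.CriticalPhenomena.PercolationContinuityZ3.Theorems.Transplant.FKConnectivityAllQAntipodalX2SpineRows
import HarnessLib

/-!
# Two-spine word model of `U¹¹` — the TWO-SPINE FIBRE SUM is an admissible family (Theorem U, part by part)

Theorem file (`--supports stmt-CriticalPhenomena-4575`), FK sub-lane `prim-bschramm-fk-2` (gen 15); builds on p205010 (kernel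
theorem, internal audit signed; external expert review pending).  One small definition, no named facts, no sorries.

For two spines `psA` (of `y` in `A`, ambient edge set `TA = A ∖ y`) and `psB` (of `z` in `B`, ambient `TB`) and a test function `h`,
the TWO-SPINE FIBRE SUM of the word pair `(u, v)` is the nested fibre sum
`fiber2 u v = fiberSum psA TA (X ↦ fiberSum psB TB (Y ↦ h(X ∪ Y)) v) u = ∑_{word X = u} ∑_{word Y = v} q^{Σ apExp} h(X ∪ Y)` (gen 14
`FK.fiberSum`).  **`FK.TwoSpine.admissible_fiber2`**: for `q > 0`, pairwise edge-disjoint TTSP parts covering the ambient sets and `h ≥ 0`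
monotone on the subsets of `TA ∪ TB`, the constant family `fiber2` is `Admissible` for every diagram without order constraints — nonnegative
and FLIP-MONOTONE in each word by gen 14's `FK.fiberSum_le_of_flip` (one Theorem U per flipped part).  This is the analytic input of the
mode induction (memo g15 §6): the word inequality `DStmt … ⟨[((o,o,o,o),0)],[]⟩` then applies to the fibre sums of an actual network.
[cite: Grimmett2006, §3.8 Thm. (3.90) (pp. 61–62)]
-/

noncomputable section

namespace Summit.CriticalPhenomena.PercolationContinuityZ3.Theorems

namespace FK

namespace TwoSpine

open X2Word

variable {V : Type*} [Fintype V] [DecidableEq V]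

/-- **Two-spine fibre sum** of the word pair `(u, v)`: the `q^{Σ apExp}`-weighted `h`-mass of the configuration pairs `(X, Y)`,
`X ⊆ TA` with word `u` along `psA`, `Y ⊆ TB` with word `v` along `psB` (a nested `FK.fiberSum`). [folklore] -/
def fiber2 (q : ℝ) (psA psB : List (SpinePart V)) (TA TB : Finset (Sym2 V)) (h : Finset (Sym2 V) → ℝ) (u v : List SLetter) : ℝ :=
  fiberSum q psA TA (fun X => fiberSum q psB TB (fun Y => h (X ∪ Y)) v) u

/-- A one-letter up-flip is a `Forall₂` flip relation of gen 14. [folklore] -/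
theorem UpFlip.forall₂ {u u' : List SLetter} (h : UpFlip u u') :
    List.Forall₂ (fun a b : SLetter => b = a ∨ (a.2 = (false, true) ∧ b = (a.1, true, false))) u u' := by
  obtain ⟨pre, suf, k, rfl, rfl⟩ := h
  have hrefl : ∀ l : List SLetter, List.Forall₂ (fun a b : SLetter => b = a ∨ (a.2 = (false, true) ∧ b = (a.1, true, false))) l l :=
    fun l => List.forall₂_same.2 fun _ _ => Or.inl rfl
  exact List.rel_append (hrefl pre) (List.Forall₂.cons (Or.inr ⟨rfl, rfl⟩) (hrefl suf))

omit [Fintype V] [DecidableEq V] in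
/-- An up-flip preserves membership in the words of a spine shape. [folklore] -/
theorem UpFlip.mem_allWords {ps : List (SpinePart V)} {u u' : List SLetter} (h : UpFlip u u') (hu : u ∈ allWords ps) : u' ∈ allWords ps := by
  obtain ⟨pre, suf, k, rfl, rfl⟩ := h
  induction ps generalizing pre with
  | nil => simp [allWords_nil] at hu
  | cons p ps ih =>
    cases pre with
    | nil =>
      rw [List.nil_append] at hu ⊢
      obtain ⟨b, bb, w, hw, hl⟩ := mem_allWords_cons.1 hu
      rw [List.cons.injEq] at hl
      obtain ⟨hk, hsuf⟩ := hl
      rw [Prod.mk.injEq] at hk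
      exact mem_allWords_cons.2 ⟨true, false, w, hw, by rw [hk.1, hsuf]⟩
    | cons l pre =>
      rw [List.cons_append] at hu ⊢
      obtain ⟨b, bb, w, hw, hl⟩ := mem_allWords_cons.1 hu
      rw [List.cons.injEq] at hl
      obtain ⟨rfl, rfl⟩ := hl
      exact mem_allWords_cons.2 ⟨b, bb, _, ih pre hw, rfl⟩

omit [Fintype V] [DecidableEq V] in
/-- The fibre sum of a non-word vanishes. [folklore] -/
theorem fiberSum_eq_zero_of_not_mem (q : ℝ) (ps : List (SpinePart V)) (T : Finset (Sym2 V)) (g : Finset (Sym2 V) → ℝ) {w : List SLetter}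
    (hw : w ∉ allWords ps) : fiberSum q ps T g w = 0 := by
  unfold fiberSum
  refine Finset.sum_eq_zero fun B hB => ?_
  exfalso
  rw [Finset.mem_filter] at hB
  exact hw (hB.2 ▸ spineWord_mem_allWords ps T B)

omit [DecidableEq V] in
/-- Flip-monotonicity of the fibre sum in its word, for a monotone section (gen 14's `fiberSum_le_of_flip`, including the non-word case). [folklore] -/
theorem fiberSum_le_of_upFlip {q : ℝ} (hq : 0 < q) {ps : List (SpinePart V)} {T : Finset (Sym2 V)} {g : Finset (Sym2 V) → ℝ}
    (hpw : ps.Pairwise fun p p' => Disjoint p.R p'.R) (hU : ∀ p ∈ ps, IsTTSP p.R p.x p.y) (hT : ∀ e ∈ T, ∃ p ∈ ps, e ∈ p.R)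
    (hg : ∀ ⦃A B : Finset (Sym2 V)⦄, A ⊆ B → B ⊆ T → g A ≤ g B) (hg0 : ∀ B ⊆ T, 0 ≤ g B) {w w' : List SLetter} (hf : UpFlip w w') :
    fiberSum q ps T g w ≤ fiberSum q ps T g w' := by
  by_cases hw : w ∈ allWords ps
  · exact fiberSum_le_of_flip hq ps T g w w' hpw hU hT hg hw hf.forall₂
  · rw [fiberSum_eq_zero_of_not_mem q ps T g hw]
    exact fiberSum_nonneg hq.le ps hg0 w'

/-- **The two-spine fibre sum is an admissible family** for every diagram without order constraints (`q > 0`, edge-disjoint TTSP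
parts covering `TA` and `TB`, `h ≥ 0` monotone on the subsets of `TA ∪ TB`). [cite: Grimmett2006, §3.8 Thm. (3.90) (pp. 61–62)] -/
theorem admissible_fiber2 {q : ℝ} (hq : 0 < q) {psA psB : List (SpinePart V)} {TA TB : Finset (Sym2 V)} {h : Finset (Sym2 V) → ℝ}
    (hpwA : psA.Pairwise fun p p' => Disjoint p.R p'.R) (hUA : ∀ p ∈ psA, IsTTSP p.R p.x p.y) (hTA : ∀ e ∈ TA, ∃ p ∈ psA, e ∈ p.R)
    (hpwB : psB.Pairwise fun p p' => Disjoint p.R p'.R) (hUB : ∀ p ∈ psB, IsTTSP p.R p.x p.y) (hTB : ∀ e ∈ TB, ∃ p ∈ psB, e ∈ p.R)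
    (hmono : ∀ ⦃C D : Finset (Sym2 V)⦄, C ⊆ D → D ⊆ TA ∪ TB → h C ≤ h D) (hnn : ∀ C ⊆ TA ∪ TB, 0 ≤ h C)
    (nodes : List (Modes × ℕ)) :
    Admissible ⟨nodes, []⟩ (fun _ => fiber2 q psA psB TA TB h) where
  nonneg _ u v := fiberSum_nonneg hq.le psA (fun X hX => fiberSum_nonneg hq.le psB
    (fun Y hY => hnn _ (Finset.union_subset_union hX hY)) v) u
  monoA _ u u' v hf := by
    refine fiberSum_le_of_upFlip hq hpwA hUA hTA (fun X X' hXX' hX' => ?_) (fun X hX => ?_) hf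
    · exact fiberSum_mono hq.le psB (fun Y hY => hmono (Finset.union_subset_union hXX' le_rfl)
        (Finset.union_subset_union hX' hY)) v
    · exact fiberSum_nonneg hq.le psB (fun Y hY => hnn _ (Finset.union_subset_union hX hY)) v
  monoB _ u v v' hf := by
    refine fiberSum_mono hq.le psA (fun X hX => ?_) u
    exact fiberSum_le_of_upFlip hq hpwB hUB hTB (fun Y Y' hYY' hY' => hmono (Finset.union_subset_union le_rfl hYY')
      (Finset.union_subset_union hX hY')) (fun Y hY => hnn _ (Finset.union_subset_union hX hY)) hf
  le p hp := by simp at hp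

end TwoSpine

end FK

end Summit.CriticalPhenomena.PercolationContinuityZ3.Theorems

end
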